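import Summits.Schanuel.Schanuel.Theorems.RootDecomp1BTwoStorey03

/-!
# RootDecomp1BTwoStorey — lens 4, generation 43 «TWO-PARAMETER RADICAL DESCENT: STOREY THREE AT (1, ρ, σ)» (lane B-R26 (e); CLAIM L2197, ACK/CHECKLIST B-g43 L2199, NODE L2206 / REQUEST L2207, writer re-check L2211, critic VERDICT L2210: CLEARED — ONE CELL (lane (e) «m = 3 storeys»; engine VARIANT-REACH+ of g30, class NEW-LOCAL, territory NEW); RULE B-R29; lens-4 tally THEOREM ×7 + CELL ×4) — continuation (RootDecomp1BTwoStorey04): §C part 3 (Baire density of JU, controls)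

(lens-4 g43 HOME kernel K = HOME/decomp-schanuel-lens-4/g43/TwoStorey.lean 24f29895…, 1683 l; VERDICT L2210 PORT GO; port by census-1 gen 19 as `RootDecomp1BTwoStorey01`–`06`: 01 = §A formal algebra + §B sizes; 02 = §D-data + §C part 1 (classes `UltraLiouville₂` / `JU`); 03 = §C part 2 (collision, two-dimensional non-vanishing, typed obstruction); 04 = §C part 3 (Baire density, controls); 05 = §D kernel `algebraicIndependent_radical₂` (pending cap edition); 06 = §E storey-three cells.
PORT EDITS: class defs' docstrings tagged «[class] definition …»; private port copies of length lemmas kept private (per-part private copies where a later part uses them); statements and proofs verbatim. `--supports stmt-Schanuel-24622`; no census credit carried; rung 0 — nothing here proves Schanuel.)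
-/

noncomputable section

open Complex

namespace Summit.Schanuel.Schanuel.Theorems.RootDecomp1BTwoStorey

open Summit.Schanuel.Schanuel.Theorems.RootDecomp1BRadicalDescent (resFin resFin_val powSubst powSubst_X_self
  powSubst_eq_zero_iff QDiv qdiv_powSubst residue_lemma)

section PortCopies2
open MvPolynomial
open Summit.Schanuel.Schanuel.Theorems.RootDecomp1KHyper (mvlen mvlen_nonneg mvlen_eq_sum_of_support_subset)
variable {n : ℕ}

end PortCopies2

section ClassJU
open MvPolynomial
open Summit.Schanuel.Schanuel.Theorems.RootDecomp1BRadicalDescent (UltraLiouville DExpMeasure)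
open Summit.Schanuel.Schanuel.Theorems.RootDecomp1KHyper (mvlen mvlen_nonneg one_le_mvlen mvaeval_int_map)

variable {ρ σ : ℝ}

/-- countability of rational polynomials in two variables [folklore; as `RootDecomp1EGenericityFloor03`]. -/
private theorem countable_mvPolynomial_rat_two : Countable (MvPolynomial (Fin 2) ℚ) :=
  Function.Injective.countable
    (f := (AddMonoidAlgebra.coeff : MvPolynomial (Fin 2) ℚ → (Fin 2 →₀ ℕ) →₀ ℚ))
    AddMonoidAlgebra.coeff_injective

/-- **The real zero set of a nonzero rational polynomial in two variables has EMPTY INTERIOR** (identity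
theorem for the real-analytic map `(x, y) ↦ p(x, y)` on the connected plane, then `MvPolynomial.funext`). -/
theorem dense_setOf_aeval_ne_zero (p : MvPolynomial (Fin 2) ℚ) (hp : p ≠ 0) :
    Dense {v : ℝ × ℝ | aeval ![v.1, v.2] p ≠ 0} := by
  set p' : MvPolynomial (Fin 2) ℝ := map (algebraMap ℚ ℝ) p with hp'
  have hp'0 : p' ≠ 0 := fun h => hp (map_injective _ (algebraMap ℚ ℝ).injective (by rw [← hp', h, map_zero]))
  have hev : ∀ v : ℝ × ℝ, aeval ![v.1, v.2] p = eval ![v.1, v.2] p' := by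
    intro v; rw [hp', eval_map, aeval_def]
  -- the evaluation map is real-analytic on the plane
  set g : ℝ × ℝ → ℝ := fun v => eval ![v.1, v.2] p' with hg
  have hlin : ∀ v : ℝ × ℝ, (fun i => (![LinearMap.fst ℝ ℝ ℝ, LinearMap.snd ℝ ℝ ℝ] i) v) = ![v.1, v.2] := by
    intro v; funext i; fin_cases i <;> simp
  have hga : AnalyticOnNhd ℝ g Set.univ := by
    have := AnalyticOnNhd.eval_linearMap' (𝕜 := ℝ) (E := ℝ × ℝ) ![LinearMap.fst ℝ ℝ ℝ, LinearMap.snd ℝ ℝ ℝ] p'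
    simp_rw [hlin] at this
    exact this
  have hset : {v : ℝ × ℝ | aeval ![v.1, v.2] p ≠ 0} = {v | g v = 0}ᶜ := by
    ext v; simp [hev, hg]
  rw [hset, ← interior_eq_empty_iff_dense_compl, Set.eq_empty_iff_forall_notMem]
  intro z₀ hz₀
  have hnhds : {v : ℝ × ℝ | g v = 0} ∈ nhds z₀ := mem_interior_iff_mem_nhds.1 hz₀
  have hfz : g =ᶠ[nhds z₀] 0 := Filter.mem_of_superset hnhds fun v hv => hv
  have hall := hga.eqOn_zero_of_preconnected_of_eventuallyEq_zero isPreconnected_univ (Set.mem_univ z₀) hfz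
  apply hp'0
  apply MvPolynomial.funext
  intro w
  have h1 := hall (Set.mem_univ (w 0, w 1))
  simp only [hg, Pi.zero_apply] at h1
  have hw : ![w 0, w 1] = w := by funext i; fin_cases i <;> rfl
  rw [hw] at h1
  rw [h1, map_zero]

/-- **BAIRE NON-VACUITY (hypothesis-free).** The pairs that are jointly ultra-Liouville AND algebraically
independent form a comeagre (in particular dense) subset of `ℝ²`: `⋂_m ⋃_{q ≥ m, a, b} B((a/q, b/q), e^{−e^{q^m}})`
is a dense `G_δ`, and the algebraically DEpendent pairs lie on countably many nowhere dense real algebraic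
curves `{p(x, y) = 0}`, `p ∈ ℚ[Y₁, Y₂] ∖ 0` (`dense_setOf_aeval_ne_zero`). -/
theorem dense_setOf_ultraLiouville₂_algebraicIndependent :
    Dense {v : ℝ × ℝ | UltraLiouville₂ v.1 v.2 ∧ AlgebraicIndependent ℚ ![(v.1 : ℂ), (v.2 : ℂ)]} := by
  classical
  haveI := countable_mvPolynomial_rat_two
  -- the joint-approximation opens
  let U : ℕ → Set (ℝ × ℝ) := fun m => ⋃ q : {q : ℕ // m ≤ q ∧ 1 ≤ q}, ⋃ a : ℤ, ⋃ b : ℤ,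
    Metric.ball (((a : ℝ) / (q : ℕ), (b : ℝ) / (q : ℕ)) : ℝ × ℝ) (Real.exp (-Real.exp (((q : ℕ) : ℝ) ^ m)))
  have hUo : ∀ m, IsOpen (U m) := fun m =>
    isOpen_iUnion fun _ => isOpen_iUnion fun _ => isOpen_iUnion fun _ => Metric.isOpen_ball
  have hUd : ∀ m, Dense (U m) := by
    intro m
    rw [Metric.dense_iff]
    intro v ε hε
    obtain ⟨Q, hQ⟩ := exists_nat_gt (1 / ε)
    set q : ℕ := max (max m 1) Q with hq
    have hq1 : 1 ≤ q := (le_max_right _ _).trans (le_max_left _ _)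
    have hq0r : (0 : ℝ) < q := by exact_mod_cast hq1
    have hqε : 1 / (q : ℝ) < ε := by
      have : (Q : ℝ) ≤ q := by exact_mod_cast le_max_right _ _
      rw [div_lt_iff₀ hq0r]
      rw [div_lt_iff₀ hε] at hQ
      nlinarith
    set a : ℤ := ⌊v.1 * q⌋ with ha
    set b : ℤ := ⌊v.2 * q⌋ with hb
    have hnear : ∀ (t : ℝ) , |t - (⌊t * q⌋ : ℝ) / q| < ε := by
      intro t
      have h1 : (⌊t * q⌋ : ℝ) ≤ t * q := Int.floor_le _
      have h2 : t * q < (⌊t * q⌋ : ℝ) + 1 := Int.lt_floor_add_one _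
      have h3 : t - (⌊t * q⌋ : ℝ) / q = (t * q - ⌊t * q⌋) / q := by field_simp
      rw [h3, abs_of_nonneg (div_nonneg (by linarith) hq0r.le), div_lt_iff₀ hq0r]
      have : 1 < ε * q := by rwa [div_lt_iff₀ hq0r] at hqε
      linarith
    refine ⟨((a : ℝ) / q, (b : ℝ) / q), ?_, ?_⟩
    · rw [Metric.mem_ball, Prod.dist_eq, Real.dist_eq, Real.dist_eq, max_lt_iff, abs_sub_comm,
        abs_sub_comm ((b : ℝ) / q)]
      exact ⟨hnear v.1, hnear v.2⟩
    · refine Set.mem_iUnion.2 ⟨⟨q, (le_max_left _ _).trans (le_max_left _ _), hq1⟩,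
        Set.mem_iUnion.2 ⟨a, Set.mem_iUnion.2 ⟨b, Metric.mem_ball_self (Real.exp_pos _)⟩⟩⟩
  have hUsub : (⋂ m, U m) ⊆ {v : ℝ × ℝ | UltraLiouville₂ v.1 v.2} := by
    intro v hv m
    obtain ⟨⟨q, hqm, hq1⟩, hmem⟩ := Set.mem_iUnion.1 (Set.mem_iInter.1 hv m)
    obtain ⟨a, hmem⟩ := Set.mem_iUnion.1 hmem
    obtain ⟨b, hmem⟩ := Set.mem_iUnion.1 hmem
    rw [Metric.mem_ball, Prod.dist_eq, Real.dist_eq, Real.dist_eq, max_lt_iff] at hmem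
    exact ⟨q, a, b, hqm, hmem.1, hmem.2⟩
  -- the algebraic-independence opens
  let V : MvPolynomial (Fin 2) ℚ → Set (ℝ × ℝ) := fun p =>
    if p = 0 then Set.univ else {v : ℝ × ℝ | aeval ![v.1, v.2] p ≠ 0}
  have hVo : ∀ p, IsOpen (V p) := by
    intro p
    by_cases hp : p = 0
    · simp only [V, if_pos hp]; exact isOpen_univ
    · simp only [V, if_neg hp]
      have hcont : Continuous fun v : ℝ × ℝ => aeval ![v.1, v.2] p := by
        have hev : ∀ v : ℝ × ℝ, aeval ![v.1, v.2] p =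
            ∑ m ∈ p.support, ((p.coeff m : ℚ) : ℝ) * (v.1 ^ (m 0) * v.2 ^ (m 1)) := by
          intro v
          rw [MvPolynomial.aeval_def, MvPolynomial.eval₂_eq']
          refine Finset.sum_congr rfl fun m _ => ?_
          rw [Fin.prod_univ_two]
          simp
        simp_rw [hev]
        exact continuous_finsetSum _ fun m _ => continuous_const.mul
          ((continuous_fst.pow _).mul (continuous_snd.pow _))
      exact isOpen_ne_fun hcont continuous_const
  have hVd : ∀ p, Dense (V p) := by
    intro p
    by_cases hp : p = 0
    · simp only [V, if_pos hp]; exact dense_univ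
    · simp only [V, if_neg hp]; exact dense_setOf_aeval_ne_zero p hp
  have hVsub : (⋂ p, V p) ⊆ {v : ℝ × ℝ | AlgebraicIndependent ℚ ![(v.1 : ℂ), (v.2 : ℂ)]} := by
    intro v hv
    rw [Set.mem_setOf_eq, algebraicIndependent_iff]
    intro p hpv
    by_contra hp
    have hmem := Set.mem_iInter.1 hv p
    simp only [V, if_neg hp, Set.mem_setOf_eq] at hmem
    apply hmem
    have hR : (aeval ![(v.1 : ℂ), (v.2 : ℂ)] p) = ((aeval ![v.1, v.2] p : ℝ) : ℂ) := by
      rw [MvPolynomial.aeval_def, MvPolynomial.aeval_def, MvPolynomial.eval₂_eq', MvPolynomial.eval₂_eq']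
      push_cast
      refine Finset.sum_congr rfl fun m _ => ?_
      rw [Fin.prod_univ_two, Fin.prod_univ_two]
      simp
    rw [hR] at hpv
    exact_mod_cast hpv
  have h1 : (⋂ m, U m) ∈ residual (ℝ × ℝ) :=
    countable_iInter_mem.2 fun m => residual_of_dense_open (hUo m) (hUd m)
  have h2 : (⋂ p, V p) ∈ residual (ℝ × ℝ) :=
    countable_iInter_mem.2 fun p => residual_of_dense_open (hVo p) (hVd p)
  exact dense_of_mem_residual (Filter.mem_of_superset (Filter.inter_mem h1 h2)
    fun v hv => ⟨hUsub hv.1, hVsub hv.2⟩)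

/-- **`JU` is non-empty** (indeed dense in the open quadrant): Baire, hypothesis-free. -/
theorem exists_pos_pair : ∃ ρ σ : ℝ, JU ρ σ := by
  obtain ⟨v, hv, hpos⟩ := dense_setOf_ultraLiouville₂_algebraicIndependent.exists_mem_open
    (isOpen_Ioi.prod isOpen_Ioi) ⟨((1 : ℝ), (1 : ℝ)), Set.mem_Ioi.2 one_pos, Set.mem_Ioi.2 one_pos⟩
  exact ⟨v.1, v.2, hpos.1, hpos.2, hv.1, hv.2⟩

/-- `JU` pairs are dense in the open quadrant `(0, ∞)²`. -/
theorem dense_setOf_JU : Dense {v : ℝ × ℝ | 0 < v.1 → 0 < v.2 → JU v.1 v.2} :=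
  dense_setOf_ultraLiouville₂_algebraicIndependent.mono fun _ hv h1 h2 => ⟨h1, h2, hv.1, hv.2⟩

/-! ### Control lemmas (separating the class) -/

/-- CONTROL: the moment pair `(ρ, ρ²)` is NOT algebraically independent — so the frame `(1, ρ, ρ²)` is EXCLUDED
from `JU` (consistently: its storey needs TWO radicals `e^{1/Q}, e^{i/Q}`, the next lane; `X(3)` at `(1, ρ, ρ²)` is
not refuted, only out of reach of this engine). -/
theorem not_algebraicIndependent_sq (ρ : ℝ) : ¬ AlgebraicIndependent ℚ ![(ρ : ℂ), ((ρ ^ 2 : ℝ) : ℂ)] := by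
  intro h
  refine aeval_ne_zero_of_algebraicIndependent h (X 0 ^ 2 - X 1 : MvPolynomial (Fin 2) ℤ) ?_ ?_
  · intro h0
    have := congrArg (MvPolynomial.aeval ![(0 : ℤ), (-1 : ℤ)]) h0
    simp at this
  · simp

/-- … hence `(ρ, ρ²) ∉ JU`. -/
theorem not_JU_sq (ρ : ℝ) : ¬ JU ρ (ρ ^ 2) := fun h => not_algebraicIndependent_sq ρ h.2.2.2

/-- CONTROL: `(0, 0)` is jointly ultra-Liouville (so `UltraLiouville₂` alone does NOT give g30's `UltraLiouville`,
which demands approximants `≠ ρ`: the irrationality binder of `UltraLiouville₂.left/right` is load-bearing). -/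
theorem ultraLiouville₂_zero : UltraLiouville₂ 0 0 := fun m =>
  ⟨m, 0, 0, le_rfl, by simp [Real.exp_pos], by simp [Real.exp_pos]⟩

/-- … while `0` is not ultra-Liouville. -/
theorem not_ultraLiouville_zero : ¬ UltraLiouville 0 := fun h => h.irrational ⟨0, by simp⟩

end ClassJU

end Summit.Schanuel.Schanuel.Theorems.RootDecomp1BTwoStorey

end
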